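import Summits.CriticalPhenomena.PercolationContinuityZ3.Theorems.PercNearOneGluingNoHeavyLowerTailSahiCylinderComplements
import Literature.Probability.Percolation.PercolationEvents
import HarnessLib

/-!
# Kahn's Conjecture 5 for TWO complements of cylinders and an ARBITRARY decreasing event (ground set `F ∪ G`)

Support file (prover prim-ineq-prove-3 gen 12; `--supports stmt-CriticalPhenomena-4575`).  No definitions, no named facts, no sorries,
no `native_decide`.  New mathematics (memo FINDING-G12-HITTING-DECOMPOSITION.md §8b); sequel of `…SahiCylinderComplements`
(`SahiCylinderComplements.sahiE3_cylCompl_nonneg`: three cylinder complements).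

**THEOREM (`sahiE3_cylCompl_cylCompl_lower_nonneg`).**  Let `prodBernoulli p` be a product probability measure on `Set ι` (`ι` finite),
`F, G ⊆ ι` with `F ∪ G = univ`, and `W` ANY decreasing event.  Then `0 ≤ E₃({F ⊆ ω}ᶜ, {G ⊆ ω}ᶜ, W)`.

(The restriction `F ∪ G = univ` is the essential case: coordinates outside `F ∪ G` enter `E₃` only through `W` and affinely, so the general
statement follows by conditioning on them — memo §8b; that reduction is not formalised here.)

PROOF.  Write `U = Wᶜ` (an up-set; if `U = ∅` the claim is Harris for the two cylinder complements), `a = π_{F∖G}`, `b = π_{G∖F}`,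
`d = π_{F∩G}` (`π_S = ∏_{i∈S} p_i`), `A₂ = {ω | ω ∪ F ∈ U}` (determined by the coordinates off `F`), `A₁ = {ω | ω ∪ G ∈ U}`,
`σ = μ(A₂)`, `τ = μ(A₁)`, `u = μ(U)`.  Independence of disjoint coordinate blocks (`prodBernoulli_real_inter_of_determinedBy`) gives
`μ(U ∩ V_F) = a d σ`, `μ(U ∩ V_G) = b d τ`, `μ(U ∩ V_F ∩ V_G) = μ(V_F ∩ V_G) = a b d`, and — since `U ⊆ A₁ ∩ A₂` and `A₁, A₂` are determined by the
DISJOINT blocks `ι∖G`, `ι∖F` — `u ≤ σ τ`; moreover `σ ≥ b`, `τ ≥ a` (`A₂ ⊇ V_{G∖F}`).  The complement rule (`sahiE3_compl`) turns `E₃` into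
`d · [a(σ−u) + b(τ−u) − ab(1−u) − abd(1+u−σ−τ)]`, which is decreasing in `u`, and at `u = στ` equals the bilinear
`f(σ,τ) = aσ(1−τ) + bτ(1−σ) − ab(1−στ) − abd(1−σ)(1−τ) ≥ 0` on `[b,1]×[a,1]` (`ccdPoly_nonneg`).

PERCOLATION READING: with `ι = Sym2 V` restricted to the edges of a forest, `{u ↮ v}` is a cylinder complement, so every cubic row with at least
two singleton separations and any decreasing third event (e.g. row 44 `(D[ab|cy], D[a|b], D[c|y])` of the four-point frontier) holds on forests
once the ground set is the union of the two paths; the general-ground-set version is the paper theorem CC-D of the memo.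
-/

noncomputable section

namespace Summit.CriticalPhenomena.PercolationContinuityZ3.Theorems

namespace SahiCylinderComplements

open MeasureTheory Literature.Probability.LatticeModels Literature.Probability.Percolation
open scoped Classical

/-! ### The polynomial inequality -/

/-- **The two-cylinder polynomial**: for `a,b,d ∈ [0,1]`, `σ ∈ [b,1]`, `τ ∈ [a,1]`, `0 ≤ u ≤ στ`:
`0 ≤ a(σ−u) + b(τ−u) − ab(1−u) − abd(1+u−σ−τ)`. [this work] -/
theorem ccdPoly_nonneg (a b d σ τ u : ℝ) (ha : 0 ≤ a) (ha1 : a ≤ 1) (hb : 0 ≤ b) (hb1 : b ≤ 1) (hd : 0 ≤ d) (hd1 : d ≤ 1)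
    (hσb : b ≤ σ) (hσ1 : σ ≤ 1) (hτa : a ≤ τ) (hτ1 : τ ≤ 1) (hu : u ≤ σ * τ) :
    0 ≤ a * (σ - u) + b * (τ - u) - a * b * (1 - u) - a * b * d * (1 + u - σ - τ) := by
  -- (1) decreasing in u: reduce to u = στ
  have hc0 : 0 ≤ a + b - a * b + a * b * d := by nlinarith [mul_nonneg ha hb, mul_nonneg (mul_nonneg ha hb) hd]
  have hred : a * (σ - u) + b * (τ - u) - a * b * (1 - u) - a * b * d * (1 + u - σ - τ) =
      (a * σ * (1 - τ) + b * τ * (1 - σ) - a * b * (1 - σ * τ) - a * b * d * (1 - σ) * (1 - τ)) +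
        (σ * τ - u) * (a + b - a * b + a * b * d) := by ring
  have hstep : 0 ≤ (σ * τ - u) * (a + b - a * b + a * b * d) := mul_nonneg (by linarith) hc0
  -- (2) the bilinear part at u = στ, with σ = b + β, τ = a + α
  set α := τ - a with hα
  set β := σ - b with hβ
  have hα0 : 0 ≤ α := by linarith
  have hβ0 : 0 ≤ β := by linarith
  have hα1 : α ≤ 1 - a := by linarith
  have hβ1 : β ≤ 1 - b := by linarith
  have hkey : a * σ * (1 - τ) + b * τ * (1 - σ) - a * b * (1 - σ * τ) - a * b * d * (1 - σ) * (1 - τ) =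
      (1 - a) * (1 - b) * (a * b * (1 - d) + α * b + β * a) + a * b * d * α * (1 - b) + a * b * d * β * (1 - a) -
        α * β * (a + b - a * b + a * b * d) := by
    simp only [hα, hβ]; ring
  -- bound the negative term: αβ(a(1−b) + b) + αβ·abd ≤ positive terms
  have h1a : 0 ≤ 1 - a := by linarith
  have h1b : 0 ≤ 1 - b := by linarith
  have h1d : 0 ≤ 1 - d := by linarith
  have hab : 0 ≤ a * b := mul_nonneg ha hb
  -- αβ ≤ α(1−b), αβ ≤ β(1−a), αβ ≤ (1−a)(1−b)
  have e1 : α * β ≤ α * (1 - b) := mul_le_mul_of_nonneg_left hβ1 hα0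
  have e2 : α * β ≤ (1 - a) * β := mul_le_mul_of_nonneg_right hα1 hβ0
  have e3 : α * β ≤ (1 - a) * (1 - b) := mul_le_mul hα1 hβ1 hβ0 h1a
  -- assemble: f = P1+P2+P3+P4+P5 − N1 − N2 − N3 with
  --   N1 = αβa(1−b) ≤ P3 = (1−a)(1−b)βa,  N2 = αβb = αβb(1−a) + αβab,  αβb(1−a) ≤ P2 = (1−a)(1−b)αb,
  --   αβab(1+d) ≤ P1 + P4 + P5 = (1−a)(1−b)ab(1−d) + abdα(1−b) + abdβ(1−a).
  have t1 : α * β * a * (1 - b) ≤ (1 - a) * (1 - b) * (β * a) := by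
    have h0 : 0 ≤ β * a * (1 - b) := mul_nonneg (mul_nonneg hβ0 ha) h1b
    nlinarith [mul_le_mul_of_nonneg_right hα1 h0]
  have t2 : α * β * b * (1 - a) ≤ (1 - a) * (1 - b) * (α * b) := by
    have h0 : 0 ≤ α * b * (1 - a) := mul_nonneg (mul_nonneg hα0 hb) h1a
    nlinarith [mul_le_mul_of_nonneg_right hβ1 h0]
  have t3 : α * β * (a * b) * (1 + d) ≤
      (1 - a) * (1 - b) * (a * b * (1 - d)) + a * b * d * α * (1 - b) + a * b * d * β * (1 - a) := by
    have hd' : 0 ≤ a * b * d := mul_nonneg hab hd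
    have hdd : 0 ≤ a * b * (1 - d) := mul_nonneg hab h1d
    nlinarith [mul_le_mul_of_nonneg_left e1 hd', mul_le_mul_of_nonneg_left e2 hd', mul_le_mul_of_nonneg_left e3 hdd]
  have hsplit : α * β * (a + b - a * b + a * b * d) =
      α * β * a * (1 - b) + α * β * b * (1 - a) + α * β * (a * b) * (1 + d) := by ring
  nlinarith [t1, t2, t3, hstep, hred, hkey, hsplit]

/-! ### Set-theoretic preliminaries -/

variable {ι : Type*} [Fintype ι]

omit [Fintype ι] in
/-- The event "`ω` with the coordinates of `S` switched on lies in `U`" is determined by the coordinates off `S`. [folklore] -/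
theorem determinedBy_union_mem (U : Set (Set ι)) (S : Set ι) :
    DeterminedBy {ω : Set ι | ω ∪ S ∈ U} Sᶜ := by
  rw [determinedBy_iff]
  intro ω ω' h
  have : ω ∪ S = ω' ∪ S := by
    ext i
    by_cases hi : i ∈ S
    · simp [hi]
    · have := Set.ext_iff.1 h i
      simp only [Set.mem_inter_iff, Set.mem_compl_iff, hi, not_false_eq_true, and_true] at this
      simp [hi, this]
  simp only [Set.mem_setOf_eq, this]

/-! ### The theorem -/

/-- **THEOREM (two cylinder complements and an arbitrary decreasing event, ground set `F ∪ G`).**  For `F ∪ G = univ` and every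
decreasing `W`: `0 ≤ E₃({F⊆ω}ᶜ, {G⊆ω}ᶜ, W)` under every product measure. [this work] -/
theorem sahiE3_cylCompl_cylCompl_lower_nonneg (p : ι → unitInterval) (F G : Finset ι) (hFG : F ∪ G = Finset.univ)
    (W : Set (Set ι)) (hW : IsLowerSet W) :
    0 ≤ sahiE3 (prodBernoulli p) {ω : Set ι | (F : Set ι) ⊆ ω}ᶜ {ω : Set ι | (G : Set ι) ⊆ ω}ᶜ W := by
  classical
  set μ := prodBernoulli p with hμ
  set VF : Set (Set ι) := {ω | (F : Set ι) ⊆ ω} with hVF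
  set VG : Set (Set ι) := {ω | (G : Set ι) ⊆ ω} with hVG
  set U : Set (Set ι) := Wᶜ with hU
  have hWU : W = Uᶜ := by rw [hU, compl_compl]
  have hUup : IsUpperSet U := hW.compl
  -- Case U = ∅ : W = univ, E₃ = Cov of the two cylinder complements ≥ 0 (Harris)
  by_cases hUe : U = ∅
  · have hWuniv : W = Set.univ := by rw [hWU, hUe, Set.compl_empty]
    rw [hWuniv, sahiE3_def]
    simp only [Set.inter_univ, probReal_univ, mul_one, one_mul]
    have hlF : IsLowerSet VFᶜ := fun ω ω' hle hω' hω => hω' fun i hi => hle (hω hi)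
    have hlG : IsLowerSet VGᶜ := fun ω ω' hle hω' hω => hω' fun i hi => hle (hω hi)
    have h := prodBernoulli_harris_lower p hlF hlG MeasurableSet.of_discrete MeasurableSet.of_discrete
    rw [← hμ] at h
    nlinarith [h]
  -- Main case: U nonempty up-set, hence univ ∈ U
  have hUne : U.Nonempty := Set.nonempty_iff_ne_empty.2 hUe
  have htop : (Set.univ : Set ι) ∈ U := by
    obtain ⟨ω, hω⟩ := hUne
    exact hUup (Set.subset_univ ω) hω
  -- the section events
  set A₂ : Set (Set ι) := {ω | ω ∪ (F : Set ι) ∈ U} with hA₂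
  set A₁ : Set (Set ι) := {ω | ω ∪ (G : Set ι) ∈ U} with hA₁
  -- U ⊆ A₁ ∩ A₂
  have hUA : U ⊆ A₁ ∩ A₂ := fun ω hω => ⟨hUup Set.subset_union_left hω, hUup Set.subset_union_left hω⟩
  -- U ∩ VF = A₂ ∩ VF (rather VF ∩ U = VF ∩ A₂), U ∩ VG = A₁ ∩ VG
  have hUVF : VF ∩ U = VF ∩ A₂ := by
    ext ω; simp only [Set.mem_inter_iff, hVF, Set.mem_setOf_eq, hA₂]
    constructor
    · rintro ⟨h1, h2⟩; exact ⟨h1, by rwa [Set.union_eq_self_of_subset_right h1]⟩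
    · rintro ⟨h1, h2⟩; exact ⟨h1, by rwa [Set.union_eq_self_of_subset_right h1] at h2⟩
  have hUVG : VG ∩ U = VG ∩ A₁ := by
    ext ω; simp only [Set.mem_inter_iff, hVG, Set.mem_setOf_eq, hA₁]
    constructor
    · rintro ⟨h1, h2⟩; exact ⟨h1, by rwa [Set.union_eq_self_of_subset_right h1]⟩
    · rintro ⟨h1, h2⟩; exact ⟨h1, by rwa [Set.union_eq_self_of_subset_right h1] at h2⟩
  -- VF ∩ VG = {univ ⊆ ω} and VF ∩ VG ∩ U = VF ∩ VG
  have hFGset : ((F ∪ G : Finset ι) : Set ι) = Set.univ := by rw [hFG]; simp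
  have hVFG : VF ∩ VG = {ω : Set ι | ((F ∪ G : Finset ι) : Set ι) ⊆ ω} := cyl_inter_cyl F G
  have hVFGU : VF ∩ VG ∩ U = VF ∩ VG := by
    apply Set.inter_eq_left.2
    intro ω hω
    rw [hVFG, hFGset] at hω
    have : ω = Set.univ := Set.eq_univ_of_univ_subset hω
    rw [this]; exact htop
  -- independence facts (cylinders are determined by their coordinates; cf. `determinedBy_cylinder` in the tree, universe 0)
  have hdetcyl : ∀ S : Finset ι, DeterminedBy {ω : Set ι | (S : Set ι) ⊆ ω} (S : Set ι) := fun S => by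
    refine (determinedBy_iff _ _).2 fun ω ω' hωω' => ?_
    show (S : Set ι) ⊆ ω ↔ (S : Set ι) ⊆ ω'
    rw [← Set.inter_eq_right, ← Set.inter_eq_right, hωω']
  have hdetA₂ : DeterminedBy A₂ ((F : Set ι))ᶜ := determinedBy_union_mem U F
  have hdetA₁ : DeterminedBy A₁ ((G : Set ι))ᶜ := determinedBy_union_mem U G
  have hμFA : μ.real (VF ∩ A₂) = μ.real VF * μ.real A₂ :=
    prodBernoulli_real_inter_of_determinedBy p F (hdetcyl F) hdetA₂ MeasurableSet.of_discrete MeasurableSet.of_discrete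
  have hμGA : μ.real (VG ∩ A₁) = μ.real VG * μ.real A₁ :=
    prodBernoulli_real_inter_of_determinedBy p G (hdetcyl G) hdetA₁ MeasurableSet.of_discrete MeasurableSet.of_discrete
  -- u ≤ σ τ : A₁ determined by univ \ G, A₂ by univ \ F, disjoint
  have hdisj : Disjoint (Finset.univ \ G) (Finset.univ \ F) := by
    rw [Finset.disjoint_left]
    intro i hiG hiF
    simp only [Finset.mem_sdiff, Finset.mem_univ, true_and] at hiG hiF
    have : i ∈ F ∪ G := by rw [hFG]; exact Finset.mem_univ i
    rcases Finset.mem_union.1 this with h | h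
    · exact hiF h
    · exact hiG h
  have hdetA₁' : DeterminedBy A₁ ((Finset.univ \ G : Finset ι) : Set ι) :=
    hdetA₁.mono fun i hi => by simpa using hi
  have hdetA₂' : DeterminedBy A₂ ((Finset.univ \ F : Finset ι) : Set ι) :=
    hdetA₂.mono fun i hi => by simpa using hi
  have hμA : μ.real (A₁ ∩ A₂) = μ.real A₁ * μ.real A₂ :=
    prodBernoulli_real_inter_of_determinedBy_disjoint p hdisj hdetA₁' hdetA₂' MeasurableSet.of_discrete MeasurableSet.of_discrete
  have hu_le : μ.real U ≤ μ.real A₁ * μ.real A₂ := by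
    rw [← hμA]; exact measureReal_mono hUA
  -- σ ≥ b, τ ≥ a
  have hA₂sup : {ω : Set ι | ((G \ F : Finset ι) : Set ι) ⊆ ω} ⊆ A₂ := by
    intro ω hω
    simp only [Set.mem_setOf_eq, Finset.coe_sdiff] at hω
    simp only [hA₂, Set.mem_setOf_eq]
    have : ω ∪ (F : Set ι) = Set.univ := by
      apply Set.eq_univ_of_forall
      intro i
      by_cases hi : i ∈ F
      · exact Or.inr (Finset.mem_coe.2 hi)
      · have hiG : i ∈ G := by
          have : i ∈ F ∪ G := by rw [hFG]; exact Finset.mem_univ i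
          rcases Finset.mem_union.1 this with h | h
          · exact absurd h hi
          · exact h
        exact Or.inl (hω ⟨Finset.mem_coe.2 hiG, fun h => hi (Finset.mem_coe.1 h)⟩)
    rw [this]; exact htop
  have hA₁sup : {ω : Set ι | ((F \ G : Finset ι) : Set ι) ⊆ ω} ⊆ A₁ := by
    intro ω hω
    simp only [Set.mem_setOf_eq, Finset.coe_sdiff] at hω
    simp only [hA₁, Set.mem_setOf_eq]
    have : ω ∪ (G : Set ι) = Set.univ := by
      apply Set.eq_univ_of_forall
      intro i
      by_cases hi : i ∈ G
      · exact Or.inr (Finset.mem_coe.2 hi)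
      · have hiF : i ∈ F := by
          have : i ∈ F ∪ G := by rw [hFG]; exact Finset.mem_univ i
          rcases Finset.mem_union.1 this with h | h
          · exact h
          · exact absurd h hi
        exact Or.inl (hω ⟨Finset.mem_coe.2 hiF, fun h => hi (Finset.mem_coe.1 h)⟩)
    rw [this]; exact htop
  have hσb : ∏ i ∈ G \ F, (p i : ℝ) ≤ μ.real A₂ := by
    rw [← prodBernoulli_real_subset p (G \ F), ← hμ]; exact measureReal_mono hA₂sup
  have hτa : ∏ i ∈ F \ G, (p i : ℝ) ≤ μ.real A₁ := by
    rw [← prodBernoulli_real_subset p (F \ G), ← hμ]; exact measureReal_mono hA₁sup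
  -- products as Venn products (ground set: F ∪ G = univ)
  set a := ∏ i ∈ F \ G, (p i : ℝ) with ha
  set b := ∏ i ∈ G \ F, (p i : ℝ) with hb
  set d := ∏ i ∈ F ∩ G, (p i : ℝ) with hd
  have eF : ∏ i ∈ F, (p i : ℝ) = a * d := by
    rw [ha, hd, ← Finset.prod_union (Finset.disjoint_left.2 fun i h1 h2 => (Finset.mem_sdiff.1 h1).2 (Finset.mem_inter.1 h2).2)]
    congr 1; ext i; simp only [Finset.mem_union, Finset.mem_sdiff, Finset.mem_inter]; tauto
  have eG : ∏ i ∈ G, (p i : ℝ) = b * d := by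
    rw [hb, hd, ← Finset.prod_union (Finset.disjoint_left.2 fun i h1 h2 => (Finset.mem_sdiff.1 h1).2 (Finset.mem_inter.1 h2).1)]
    congr 1; ext i; simp only [Finset.mem_union, Finset.mem_sdiff, Finset.mem_inter]; tauto
  have eFG : ∏ i ∈ F ∪ G, (p i : ℝ) = a * b * d := by
    have h1 : Disjoint (F \ G) (G \ F) := Finset.disjoint_left.2 fun i h1 h2 => (Finset.mem_sdiff.1 h1).2 (Finset.mem_sdiff.1 h2).1
    have h2 : Disjoint (F \ G ∪ G \ F) (F ∩ G) := Finset.disjoint_left.2 fun i hi h3 => by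
      rcases Finset.mem_union.1 hi with h | h
      · exact (Finset.mem_sdiff.1 h).2 (Finset.mem_inter.1 h3).2
      · exact (Finset.mem_sdiff.1 h).2 (Finset.mem_inter.1 h3).1
    rw [ha, hb, hd, ← Finset.prod_union h1, ← Finset.prod_union h2]
    congr 1; ext i; simp only [Finset.mem_union, Finset.mem_sdiff, Finset.mem_inter]; tauto
  -- measures of the cylinders and intersections
  have mVF : μ.real VF = a * d := by rw [hμ, hVF, prodBernoulli_real_subset, eF]
  have mVG : μ.real VG = b * d := by rw [hμ, hVG, prodBernoulli_real_subset, eG]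
  have mVFG : μ.real (VF ∩ VG) = a * b * d := by rw [hVFG, hμ, prodBernoulli_real_subset, eFG]
  -- bounds on a b d σ τ u
  have ha0 : 0 ≤ a := Finset.prod_nonneg fun i _ => (p i).2.1
  have ha1 : a ≤ 1 := Finset.prod_le_one (fun i _ => (p i).2.1) fun i _ => (p i).2.2
  have hb0 : 0 ≤ b := Finset.prod_nonneg fun i _ => (p i).2.1
  have hb1 : b ≤ 1 := Finset.prod_le_one (fun i _ => (p i).2.1) fun i _ => (p i).2.2
  have hd0 : 0 ≤ d := Finset.prod_nonneg fun i _ => (p i).2.1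
  have hd1 : d ≤ 1 := Finset.prod_le_one (fun i _ => (p i).2.1) fun i _ => (p i).2.2
  have hσ1 : μ.real A₂ ≤ 1 := by rw [hμ]; exact measureReal_le_one
  have hτ1 : μ.real A₁ ≤ 1 := by rw [hμ]; exact measureReal_le_one
  have hpoly := ccdPoly_nonneg a b d (μ.real A₂) (μ.real A₁) (μ.real U) ha0 ha1 hb0 hb1 hd0 hd1 hσb hσ1 hτa hτ1
    (by rw [mul_comm]; exact hu_le)
  -- rewrite E₃
  have hm : ∀ S : Set (Set ι), MeasurableSet S := fun S => MeasurableSet.of_discrete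
  rw [hWU, sahiE3_compl μ (hm _) (hm _) (hm _), sahiE3_def]
  rw [hVFGU, hUVF, hUVG, hμFA, hμGA, mVF, mVG, mVFG]
  have hid : a * b * d - a * d * (b * d) + (a * d * μ.real A₂ - a * d * μ.real U) + (b * d * μ.real A₁ - b * d * μ.real U) -
      (2 * (a * b * d) + a * d * (b * d) * μ.real U -
        (a * d * (b * d * μ.real A₁) + b * d * (a * d * μ.real A₂) + μ.real U * (a * b * d))) =
      d * (a * (μ.real A₂ - μ.real U) + b * (μ.real A₁ - μ.real U) - a * b * (1 - μ.real U) -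
        a * b * d * (1 + μ.real U - μ.real A₂ - μ.real A₁)) := by ring
  rw [hid]
  exact mul_nonneg hd0 hpoly

end SahiCylinderComplements

end Summit.CriticalPhenomena.PercolationContinuityZ3.Theorems
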